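import Mathlib
import HarnessLib
import HarnessLib.Audit
import Summits.Langlands.Statement
import Literature.NumberTheory.GaloisRepresentations.LocalGaloisGroup

/-!
Route: AlgebraicTraceRigidity

CLOSED (retired) 2026-08-15T13:48:38Z by operator:999:1257524 — reason: not-a-thesis: assembly does not conclude the sub-problem Statement — note: D-0027 §2.1 audit (human 2026-08-15: routes that do not decide the summit are removed): the assembly concludes `Target`, not the sub-problem statement; a NEW conforming route may be opened from the same idea (generated `closes : … → _root_.Langlands`).. The file is kept as the record of this route; refuted decls are indexed as negative knowledge (`ledger negatives`).

# Route AlgebraicTraceRigidity — ATR — traces in a number field force de Rham; to first order at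
Artin points by Roy's p-adic rank theorem, and exactly on the ordinary weight-one locus of GL2/Q

ALGEBRAIC-TRACE RIGIDITY (ATR; card algebraic-trace-rigidity-tangent-rank, same conjecture as the
sibling card
trace-field-rigidity-transcendence): an irreducible, almost everywhere unramified ρ : Γ_F →
GL_n(ℚ̄_p) whose Frobenius
characteristic polynomials lie in E[X] for ONE number field E is de Rham at the places above p — so
the de Rham clause of
direction (A) of the summit is discharged by the Hecke field alone (support
RationalToGeometricWiring: ATR ∧ (A)_rat → (A),
proved in Sketch.lean). It suffices to show X = X₁ ∧ X₂, the two datum-free sectors of ATR over ℚ, n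
= 2, where "de Rham at
Artin weight" has the elementary avatar "finite image of inertia at p": X₁ = TangentRigidity (ATR to
first order: no
first-order deformation ρ̃ : Γ_ℚ → GL₂(ℚ̄_p[ε]) of an odd irreducible Artin ρ has all its
Frobenius-trace derivatives in
c₀·ℚ̄ unless they vanish a.e. — the theorem-candidate, by Roy's p-adic rank/dimension theorem) and
X₂ =
OrdinaryArtinWeightRigidity (ATR on the ordinary Artin-weight locus: irreducible + a.e. unramified +
E-rational + ordinary
with finite-order diagonal inertial characters at p ⇒ ρ(I_p) finite, i.e. no non-classical ordinary
weight-one point has a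
Hecke field of finite degree).
Lean: `TangentRigidity ∧ OrdinaryArtinWeightRigidity`

## Assembly
Pure logic (And.intro; Sketch.lean `assembly_holds`, rc 0): the two sector statements are the two
conjuncts of the target X.
The link to the summit statement is the support item RationalToGeometricWiring (ATR(𝓡) ∧ (A)_rat(𝓡)
→ AutomorphicToGalois n 𝓡
hcpt for every F, 𝓡, n), in which X₂ is the datum-free GL₂/ℚ Artin-weight instance of the hypothesis
ATR(𝓡) (finite inertia
image at p = de Rham of weights (0,0)) and X₁ its first-order jet at classical points.

Rationale: WHY THIS LINE. Global class field theory of the adjoint splitting field H writes every first-order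
deformation class of an Artin ρ as
Ψ_v ∘ Log for a matrix v ∈ gl₂(ℚ̄_p) killing the unit logarithms, and the derivative of tr
ρ̃(Frob_ℓ) as the ℚ̄-LINEAR FORM
−(1/fh) Σ_g tr(v ρ(g⁻¹σ_ℓ g)) log_p ι(g⁻¹α_𝔩) in p-adic logarithms of ℓ-units of H (DLR 2017,
doi:10.1007/978-3-319-69712-3_4,
Thm 1.9 and Remark 1, for the canonical weight direction; here for all of H¹): "E-rational to first
order" says that the
K-hyperplane ker(v, −c₀) ⊂ K⁵ (K = ℂ_p) contains, for every admissible prime ℓ, the point (Λ₁(ℓ), …,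
Λ₄(ℓ), q_ℓ) of 𝓛̃⁵
(𝓛̃ = ℚ̄ + ℚ̄·L, L = ℚ-span of p-adic logs of algebraic numbers) — unboundedly many ℚ̄-independent
points with PRIVATE
logarithms (Baker–Brumer, Brumer1967), against Roy's theorem dim_ℚ̄(U ∩ 𝓛̃^d) ≤ φ(n, d), φ(4,5) = 20
(Roy1992 Thm 4–5, stated
for K = ℂ or ℂ_p, read pp. 24, 34–41). The imported area is transcendence theory (Baker–Brumer; the
Waldschmidt–Roy linear
subgroup theorem, Waldschmidt1981, Roy1992, used p-adically on Artin regulator matrices by Maksoud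
arXiv:2201.08203 §2.2 —
there with Roy's θ-bound, which gives half ranks); no route of this summit uses transcendence as an
engine (34 Theses files
grepped), and the negatives index has no statement of this kind. The rank-one shadow is known (DLR
Adv. Math. 2015
doi:10.1016/j.aim.2015.07.007 Cor. 2: the ℚ̄-q-expansion principle fails on the RM generalised
eigenspace, by Baker–Brumer;
Bellaïche–Dimitrov arXiv:1301.0712 use Baker–Brumer on the same tangent spaces); dim H¹ ≥ 2 makes
the elimination quadratic
in logarithms, where only a rank/dimension theorem speaks. ATR itself is Khare's printed question
(arXiv:math/0210403 §4
Q. 3) and is recorded open by Böckle–Hui (arXiv:2404.08954 p. 3); the abelian case is the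
Serre–Henniart–Waldschmidt theorem.

RANKED CRUXES. #0 Target (target) — X = X₁ ∧ X₂ as in § Thesis: ATR to first order at odd Artin
points of GL₂/ℚ (TangentRigidity) and ATR on the ordinary Artin-weight locus of GL₂/ℚ
(OrdinaryArtinWeightRigidity). (why it might fail: X₂ is an open transcendence statement of
p-adic-Schanuel strength; X₁ could fail at a classical point whose Frobenius/unit log-matrix is
degenerate for Roy's Thm 4 (every block shape must be excluded); either conjunct false kills X.)
[Roy1992, Khare2002, DarmonLauderRotger2017, Hida2010]
#2 TangentRigidity (crux) — T1 of the card (tangent rigidity at Artin points, GL₂/ℚ, ALL of H¹(G_ℚ,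
ad ρ) incl. the determinant direction): p prime, ρ : Γ_ℚ → GL₂(ℚ̄_p) continuous with finite image,
irreducible, odd; ρ̃ : Γ_ℚ → GL₂(ℚ̄_p[ε]) a continuous first-order deformation (fst ∘ ρ̃ = ρ)
unramified at almost all v; if for some c₀ ∈ ℚ̄_p the ε-parts of tr ρ̃(Frob_v) lie in c₀·ℚ̄ for
almost all v (every arithmetic Frobenius at every prime above v), then they vanish for almost all v
(equivalently, by Chebotarev + Carayol, ρ̃ is conjugate to the constant deformation). Proof route:
CFT parametrisation of H¹ by v ∈ gl₂ with unit constraints; derivative = ℚ̄-linear form in p-adic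
logs of ℓ-units of the ad⁰ρ-field H (DLR 2017 Thm 1.9 generalised); the ℚ̄-span Z ⊂ 𝓛̃⁵ of ≥ 21
prime columns (Λ(ℓ), q_ℓ), ℓ spread over every regular Frobenius class, lies in U = K·Z ⊂ ker(v,
−c₀) ≠ K⁵; Roy 1992 Thm 4 (K = ℂ_p)/Thm 5 (dim_ℚ̄(U ∩ 𝓛̃⁵) ≤ φ(n,5) ≤ 20 when U ∩ ℚ̄⁵ = 0 and U is
in no proper rational subspace) plus a census of rational subspaces T ⊂ K⁵ (prime columns carry
private logarithms by Baker–Brumer; the X-coefficient vectors of prime ℓ lie in the centralizer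
plane span(1, ρ(Frob_𝔩)); for each nonzero w ∈ gl₂(ℚ̄) at least N chosen primes have tr(w ρ(Frob_𝔩))
≠ 0) gives the contradiction. [difficulty: L] (why it might fail: Card's dl/(d+l) count fails
(algebraic row: Roy's theta = 1, rank >= half only); repair via Roy 1992 Thm 4/5 (phi(4,5)=20) needs
a census of ALL Qbar-rational subspaces of K^5 against prime columns, uniform in Frobenius torus
directions; one uncounted degenerate subspace leaves rank 4 consistent.) [Roy1992, Brumer1967,
Waldschmidt1981, DarmonLauderRotger2017, BellaicheDimitrov2013, DarmonLauderRotger2015AdvMath,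
Maksoud2022]
#3 OrdinaryArtinWeightRigidity (crux) — ATR on the ordinary Artin-weight locus of GL₂/ℚ (the card's
Rung 2 = weight-one fibre of Hida families, stated for all such ρ): p prime, ρ : Γ_ℚ → GL₂(ℚ̄_p)
continuous, irreducible, unramified at almost all v, E-rational (a number field E ⊂ ℚ̄_p contains
the Frobenius characteristic polynomials at almost all v), and at v = p ordinary of Artin weight (in
some frame ρ|_{Γ_{ℚ_p}} is upper triangular with both diagonal characters of finite order m on the
inertia group absInertia ℚ_p); then ρ(I_p) is finite (equivalently ρ|_{Γ_{ℚ_p}} is potentially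
unramified = de Rham of Hodge–Tate weights (0,0); with oddness this is a classical weight-one
point). Contrapositive: a non-classical ordinary p-adic eigenform of weight one has a Hecke field of
infinite degree. No parity hypothesis (ATR has none). [difficulty: open-problem] (why it might fail:
Values of a non-CM Hida family's Iwasawa functions at zeta-1, finitely far from the classical point,
have no closed form in logs; joint irrationality is of p-adic-Schanuel strength, beyond Baker-Roy
methods; one ordinary non-classical weight-one eigenform with number-field eigenvalues kills it.)
[Hida2010, doi:10.1007/978-3-319-41424-9_4, Kisin2003, Khare2002, arXiv:math/0309283, BockleHui2024,
BuzzardGeeLMS2014]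
#9 TangentRigidityCM (support) — The CM case of T1 with fixed determinant — the rank-one shadow
provable from Baker–Brumer alone: ρ as in TangentRigidity and moreover reducible on Γ_K for an
imaginary quadratic K (ρ ≅ Ind_K^ℚ χ), ρ̃ with det ρ̃ constant to first order; then H¹(ad⁰ρ) =
(anticyclotomic line) ⊕ (line from Ind(χ/χ^c)), the two lines have derivatives supported on split,
resp. inert, primes, each a single log-form up to the unknown scalar, and ratios of two of them are
ℚ̄-irrational by Brumer (private ℓ-unit logarithms) unless the forms vanish (χ(λ) = χ(λ̄), resp.
tr(v_ψ ρ(Frob_ℓ)) = 0), which Chebotarev defeats. Calibration item (DLR 2017 Thms 2.1 and CM-p-inert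
give the explicit coefficients in this case); a corollary of TangentRigidity (Sketch.lean:
tangentRigidityCM_of_tangentRigidity). [difficulty: M] [Brumer1967, DarmonLauderRotger2017,
DarmonLauderRotger2015, BellaicheDimitrov2013]
#9 RationalToGeometricWiring (support) — The summit wiring of ATR (card N4), for every number field
F, reciprocity data 𝓡, n and level hypothesis hcpt: if every irreducible E-rational (a.e.
unramified, Frobenius polynomials in E[X] for one number field E ⊂ ℚ̄_ℓ) ρ : Γ_F → GL_n(ℚ̄_ℓ) is
IsGeometricFramed 𝓡 ρ (ATR(𝓡)), and every L-algebraic cuspidal π has for all ℓ, ι an irreducible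
E-rational ρ with Corresponds 𝓡 ι π ρ, unique up to conjugacy ((A)_rat), then AutomorphicToGalois n
𝓡 hcpt. Two-line term proof (Sketch.lean: rationalToGeometricWiring_holds, rc 0). It records
formally where ATR plugs into the summit: (A)_rat keeps Satake matching and local–global
compatibility and drops only the explicit de Rham clause. [difficulty: provable-now]
[BuzzardGeeLMS2014, FontaineMazurGeometric1995, planner Sketch.lean (rc 0)]

TWO-LAYER PLAN. Foreseen glued splits (k ≤ 3, depth 1), filed only once a crux moves:
TangentRigidity ⇐ TangentClassesFromUnits (every
first-order class is Ψ_v ∘ Log with v ∈ gl₂(ℚ̄_p) killing the unit logarithms of H, and D(ℓ) =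
−(1/fh) Σ_g tr(v ρ(g⁻¹σ_ℓ g))
log_p ι(g⁻¹α_𝔩) — DLR Thm 1.9 for all of H¹) → RoyCensus (for a prime set rich in every regular
Frobenius class the column
span Z ⊂ 𝓛̃⁵ defeats every ℚ̄-rational T ⊂ K⁵ in Roy's Thm 4 inequality; needs the named facts
Brumer1967 and Roy1992 Thm 4
for K = ℂ_p and a p-adic logarithm on ℚ̄_p) → TangentRigidity. OrdinaryArtinWeightRigidity ⇐
FamilyMembership (such ρ is a
weight-one specialisation of a Hida family: R = T, known in most residually irreducible cases) →
FibreTranscendence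
(non-classical weight-one specialisations of non-CM Hida families have Hecke fields of infinite
degree) →
OrdinaryArtinWeightRigidity. A rank-4 informal crux FiniteSlopeArtinWeightRigidity (the trianguline
/ positive-slope
version = the card's UDC_p through Kisin2003 + Emerton; census-backed) is filed right after open and
typed once the
requested notion TriangulineAt lands.

KILL CRITERIA. An ordinary non-classical weight-one p-adic eigenform (equivalently an irreducible,
a.e. unramified, ordinary Artin-weight
ρ with infinite inertia image at p) whose Hecke eigenvalues lie in one number field refutes
OrdinaryArtinWeightRigidity and
ATR at once: close `refuted:OrdinaryArtinWeightRigidity` (TangentRigidity may survive as a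
stand-alone theorem but the line
to the summit is dead). A positive-slope overconvergent eigenform of weight ≤ 1 with eigenvalues in
a number field refutes
the informal finite-slope crux and ATR via Kisin2003: same close. A classical weight-one point with
an E-rational tangent
direction refutes TangentRigidity only: pivot — drop T1, keep X₂ + the finite-slope crux, expect
dormancy (the
theorem-candidate is gone). Mooted (not refuted) if de Rham-ness of all E-rational eigenvariety
limits is proved by p-adic
Hodge theory directly.

NOT DECOMPOSED YET. General n and general F (T1 over F has d = 4[F:ℚ] + 1 columns and a heavier Roy
census; ATR_n(F) itself can only be typed
relative to reciprocity data 𝓡 and is carried by RationalToGeometricWiring as a hypothesis); the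
finite-slope / trianguline
sector (informal crux until TriangulineAt); Rung 0 (n = 1: Serre III-3, Henniart 1982 Thms 2/7,
Waldschmidt 1981 — to be
vendored as Literature facts, not items); the automorphic avatar UDC_p (needs overconvergent modular
forms in Lean); the
layer-2 children of T1 (CFT parametrisation, Roy census, Chebotarev spanning) and of X₂ (family
membership, fibre
transcendence) named in the two-layer plan; the p-adic logarithm on ℚ̄_p and the named facts Brumer
1967 Thm 1, Roy 1992
Thm 4–5 / Cor. 1 for K = ℂ_p (definition + cite requests filed at open).

CHEAPEST FALSIFIER. For X₂ (kills the whole line): compute to ≥ 300 p-adic bits the U_p-ordinary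
weight-one eigenforms of a small non-CM tame
level (p ∈ {3, 5, 7}, N ≤ 50; Hida/Lauder algorithms or overconvergent modular symbols), and run
p-adic LLL on (λ(U_p), a_2,
a_3, a_5, a_7, a_11) for algebraic relations of degree ≤ 12 with planted controls — ONE algebraic
non-classical ordinary
weight-one eigenform refutes X₂ and ATR. The card's executed census (p = 2, tame level 1, weight 0,
slope 3 Buzzard–Calegari
form, 412 bits, degree ≤ 12, controls recovered: NEGATIVE) covers only the positive-slope informal
crux. For T1: DLR 2017
print p-adic expansions of first-order coefficients a_ℓ(g'_α) in RM/CM/exotic examples — test the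
ratios a_ℓ(g')/a_ℓ'(g')
for algebraicity of degree ≤ 8 by LLL at the printed precision (an algebraic ratio across two primes
contradicts T1's
mechanism). Lookup already done: Roy 1992 Thm 4 IS printed for K = ℂ_p with entries in 𝓛̃ = ℚ̄ +
ℚ̄·L (pp. 24, 34).

NUMBERS. Roy1992 Lemma p. 40: φ(n, n+1) = n(n+1), so φ(4,5) = 20 and ≥ 21 admissible ℚ̄-independent
prime columns are needed (d = 5 =
dim gl₂ + 1); Roy1992 Cor. 1: rank ≥ d·θ̃/(1+θ̃), and an algebraic row forces θ̃ ≤ 1, i.e. only rank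
≥ d/2 (why the card's
"rank 4 once l > 12" is insufficient); Roy1992 Thm 6: hyperplanes with 𝓛̃-coefficients contain
d(d−1)/2 = 10 independent
𝓛̃-points, so the bound is sharp up to 2 and the transcendental (v, −c₀) is essential; dim
H¹(G_{ℚ,{p}}, ad ρ) = 3 (2 from
ad⁰ρ, 1 cyclotomic) for odd irreducible Artin ρ regular or not (Bellaïche–Dimitrov arXiv:1301.0712,
via Baker–Brumer on
the multiplicity-one unit isotypic component); card census: 412 bits, degree ≤ 12, heights to 2^124
(deg 2) … 2^28 (deg 12),
negative. Items at open: 6 typed (+1 informal crux, +1 definition, +2 cite requests).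

DEFINITION REQUESTS. PadicLogAlgCl — the Iwasawa p-adic logarithm on (ℚ̄_p)ˣ (log_p p = 0; on
1-units the series; extended by
log(x^(q−1))/(q−1)), topic Literature/NumberTheory/Transcendental, needed to state Brumer1967 Thm 1
(p-adic Baker: ℚ̄-linear
independence of p-adic logarithms of multiplicatively independent algebraic numbers) and Roy1992 Thm
4 / Thm 5 / Cor. 1 for
K = ℂ_p as named facts (two cite items); TriangulineAt (already requested by route NewtonPatching)
for the informal
finite-slope crux.

Novelty: Searches (2026-08-15): `lit frontier Langlands --since 2022` (30 rows; none on transcendence of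
traces; noted
doi:10.1515/crelle-2026-0023 on eigencurve tangent spaces at irregular crystalline points, no
transcendence); `lit bridges
Langlands --cross any` (30 rows, no Schanuel-side bridge); `lit search --hybrid "Roy matrices whose
coefficients are linear
forms in logarithms"` (12; located the held Roy 1992, READ pp. 22–25, 34–41); `lit read
arXiv:2201.08203` (Maksoud, §2.2 Thm 3
READ: Roy's θ-bound used p-adically, half ranks); `lit read doi:10.1007/978-3-319-69712-3_4` (DLR
2017: B–D theorem, Lemma 1.8,
Thm 1.9, Remark 1 READ); `lit search --source crossref` ×2 (DLR cluster: 6; "transcendence of Hecke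
eigenvalues of
non-classical p-adic modular forms": 8, only Hida 2016 growth-of-Hecke-fields relevant); `lit galaxy
search --star all` ×3
(0, 0, 8 irrelevant); zbMATH ×2 (0), arXiv ×1 (0); S2 / OpenAlex rate-limited (HTTP 429) this
session; plus the refuter's
audited dossier on the card (AUDITOR-14: page reads of Khare 2003, KLR 2005, Böckle–Hui 2025, DLR
2017, Maksoud 2023,
Bellaïche–Dimitrov, Buzzard–Calegari; zbMATH ×12, hybrid ×8, galaxy ×8, remote 429).
Nearest prior art found: arXiv:math/0210403 (Khare 2003 §4 Question 3 = ATR as a printed question, m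
= 1 true);
doi:10.1007/978-3-319-69712-3_4 (DLR 2017 Thm 1.9 + Remark 1: tangent traces are forms in p-adic
logs of ℓ-units, "the trace
is not algebraic" for the canonical direction — the rank-one shadow); arXiv:2201.08203 (  [refs: 10.1515/crelle-2026-0023, 10.1007/978-3-319-69712-3_4`, 10.1007/978-3-319-69712-3_4, 2201.08203, math/0210403, 2404.08954, doi:10.1515/crelle-2026-0023, doi:10.1007/978-3-319-69712-3_4, Roy1992]

Barriers (technique_class: transcendence, p-adic-logarithms, roy-rank-theorem): - technique_class: transcendence, p-adic-logarithms, roy-rank-theorem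
- Literature.Barriers.Langlands.NonRegularWeightBarrier: partially evaded — the de Rham clause of
(A) at irregular (Artin) weight is certified from the Hecke field alone, with no Shimura-variety or
eigenvariety realisation and no p-adic avatar of π; NOT evaded for the existence of ρ_π or for (B);
OrdinaryArtinWeightRigidity is precisely this wall's (A)-side de Rham clause on the ordinary locus,
filed to be attacked by transcendence rather than by p-adic Hodge theory.
- Literature.Barriers.Langlands.ShimuraVarietyRealizationBarrier: same status — ATR is insensitive
to F (no totally-real/CM hypothesis anywhere; Rung 0 holds over every F); the typed cruxes are over
ℚ where realisation is not the issue; the bet is that E-rational constructions of ρ_π (congruences,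
torsion limits, pseudocharacters) are strictly easier than constructions with de Rham control.
- Literature.Barriers.Langlands.PatchingLocalComponentBarrier: not engaged — no deformation ring is
patched; T1 uses only the tangent space H¹ and class field theory of the adjoint field.
- Literature.Barriers.Langlands.TaylorWilesNumericalCoincidence: not engaged (no Taylor–Wiles
system).
- Literature.Barriers.Langlands.ResiduallyReducibleBarrier: not engaged — irreducibility of ρ itself
is a hypothesis of both cruxes; nothing residual is assumed.
- Cross-summit engine barrier (Schanuel catalogue, file
Literature/Barriers/Schanuel/AlgebraicIndependenceOfLog

History (route lifecycle, newest last):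
- 2026-08-15T13:13:22Z · rev 1: restated Target (stmt-Langlands-8553) — Target restated inline (conjunction of the two crux Props) so it has no forward references; it is definitionally TangentRigidity ∧ OrdinaryArtinWeightRigidity (planner-plancard-Langlands-Langlands-algebrai-124fe4b3-0)
- 2026-08-15T13:13:57Z · rev 2: restated Assembly (stmt-Langlands-8558) — Assembly re-filed now that Target has landed (gate had parked it on the forward reference); hypotheses reordered only, still pure logic (And.intro) (planner-plancard-Langlands-Langlands-algebrai-124fe4b3-0)
- 2026-08-15T13:14:44Z · rev 3: dropped stmt-Langlands-8570 — filed with a literal '@file' informal text by mistake (workitem add has no @file expansion); re-filing the same informal crux with the text inline (planner-plancard-Langlands-Langlands-algebrai-124fe4b3-0)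
- 2026-08-15T13:48:38Z · CLOSED retired — not-a-thesis: assembly does not conclude the sub-problem Statement (operator:999:1257524)

sub-problem: Langlands · status: closed(retired) · opened planner-plancard-Langlands-Langlands-algebrai-124fe4b3-0 2026-08-15T13:12:05Z · rev 3 · ledger route-Langlands-AlgebraicTraceRigidity
GENERATED by the gate from the ledger (D-0016/17). Provers cite these decls: `theorem foo : Summit.Langlands.Langlands.Theses.AlgebraicTraceRigidity.<Decl> := …` in Summits/Langlands/Langlands/Theorems/<Name>.lean.
-/

namespace Summit.Langlands.Langlands.Theses.AlgebraicTraceRigidity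

open scoped BigOperators Topology Manifold Classical MeasureTheory ProbabilityTheory Matrix InnerProductSpace ComplexConjugate ContinuousMap
open Filter Set Function TopologicalSpace MeasureTheory

attribute [summit_statement] _root_.Langlands

-- earlier Target (stmt-Langlands-8553, replaced 2026-08-15T13:13:22Z -> stmt-Langlands-8566): retired by None — TangentRigidity ∧ OrdinaryArtinWeightRigidity
/-- item stmt-Langlands-8566 · target · rank 0 · closed · moot by None · by planner
why it might fail: X₂ is an open transcendence statement of p-adic-Schanuel strength; X₁ could fail at a classical point whose Frobenius/unit log-matrix is degenerate for Roy's Thm 4 (every block shape must be excluded); either conjunct false kills X.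
sources: Roy1992, Khare2002, DarmonLauderRotger2017, Hida2010
[target] X = X₁ ∧ X₂ as in § Thesis: ATR to first order at odd Artin points of GL₂/ℚ
(TangentRigidity) and ATR on the ordinary Artin-weight locus of GL₂/ℚ (OrdinaryArtinWeightRigidity). -/
@[route_item "route-Langlands-AlgebraicTraceRigidity"]
def Target : Prop :=
  (∀ (p : ℕ) [Fact p.Prime] (ρ : Literature.NumberTheory.GaloisRepresentations.FramedGaloisRep ℚ (PadicAlgCl p) 2) (ρε : Literature.NumberTheory.GaloisRepresentations.FramedGaloisRep ℚ (DualNumber (PadicAlgCl p)) 2), Finite ρ.toMonoidHom.range → ρ.toGaloisRep.IsIrreducible → ρ.IsOdd → (∀ g : Field.absoluteGaloisGroup ℚ, ((ρε g).val).map TrivSqZeroExt.fst = (ρ g).val) → (∀ᶠ v : IsDedekindDomain.HeightOneSpectrum (NumberField.RingOfIntegers ℚ) in Filter.cofinite, ρε.IsUnramifiedAt v) → ∀ c₀ : PadicAlgCl p, (∀ᶠ v : IsDedekindDomain.HeightOneSpectrum (NumberField.RingOfIntegers ℚ) in Filter.cofinite, ∀ Pv ∈ v.primesAbove, ∀ σ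 : Field.absoluteGaloisGroup ℚ, IsArithFrobAt (NumberField.RingOfIntegers ℚ) σ Pv → ∃ a : PadicAlgCl p, IsAlgebraic ℚ a ∧ ((ρε σ).val.trace).snd = c₀ * a) → ∀ᶠ v : IsDedekindDomain.HeightOneSpectrum (NumberField.RingOfIntegers ℚ) in Filter.cofinite, ∀ Pv ∈ v.primesAbove, ∀ σ : Field.absoluteGaloisGroup ℚ, IsArithFrobAt (NumberField.RingOfIntegers ℚ) σ Pv → ((ρε σ).val.trace).snd = 0) ∧ (∀ (p : ℕ) [Fact p.Prime] (ρ : Literature.NumberTheory.GaloisRepresentations.FramedGaloisRep ℚ (PadicAlgCl p) 2), ρ.toGaloisRep.IsIrreducible → (∀ᶠ v : IsDedekindDomain.HeightOneSpectrum (NumberField.RingOfIntegers ℚ) in Filter.cofinite, ρ.IsUnramifiedAt v) → (∃ E : IntermediateField ℚ (PadicAlgCl p), FiniteDimensional ℚ E ∧ ∀ᶠ v : IsDedekindDomain.HeightOneSpectrum (NumberField.RingOfIntegers ℚ) in Filter.cofinite, ∃ P : Polynomial (PadicAlgCl p), (∀ i, P.coeff i ∈ E) ∧ ρ.HasFrobCharpolyAt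 v P) → ∀ v : IsDedekindDomain.HeightOneSpectrum (NumberField.RingOfIntegers ℚ), ((p : ℕ) : NumberField.RingOfIntegers ℚ) ∈ v.asIdeal → (∃ m : ℕ, 0 < m ∧ ∃ Q : Matrix.GeneralLinearGroup (Fin 2) (PadicAlgCl p), ∀ σ : Field.absoluteGaloisGroup (v.adicCompletion ℚ), (Q⁻¹ * ρ.toLocal v σ * Q).val 1 0 = 0 ∧ (σ ∈ Literature.NumberTheory.GaloisRepresentations.absInertia (v.adicCompletion ℚ) → (Q⁻¹ * ρ.toLocal v σ * Q).val 1 1 ^ m = 1 ∧ (Q⁻¹ * ρ.toLocal v σ * Q).val 0 0 ^ m = 1)) → Set.Finite ((fun σ => ρ.toLocal v σ) '' (Literature.NumberTheory.GaloisRepresentations.absInertia (v.adicCompletion ℚ) : Set (Field.absoluteGaloisGroup (v.adicCompletion ℚ)))))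

/-- item stmt-Langlands-8554 · crux · rank 2 · closed · moot by None · by planner
why it might fail: Card's dl/(d+l) count fails (algebraic row: Roy's theta = 1, rank >= half only); repair via Roy 1992 Thm 4/5 (phi(4,5)=20) needs a census of ALL Qbar-rational subspaces of K^5 against prime columns, uniform in Frobenius torus directions; one uncounted degenerate subspace leaves rank 4 consistent.
sources: Roy1992, Brumer1967, Waldschmidt1981, DarmonLauderRotger2017, BellaicheDimitrov2013, DarmonLauderRotger2015AdvMath
[crux] T1 of the card (tangent rigidity at Artin points, GL₂/ℚ, ALL of H¹(G_ℚ, ad ρ) incl. the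
determinant direction): p prime, ρ : Γ_ℚ → GL₂(ℚ̄_p) continuous with finite image, irreducible, odd;
ρ̃ : Γ_ℚ → GL₂(ℚ̄_p[ε]) a continuous first-order deformation (fst ∘ ρ̃ = ρ) unramified at almost all
v; if for some c₀ ∈ ℚ̄_p the ε-parts of tr ρ̃(Frob_v) lie in c₀·ℚ̄ for almost all v (every
arithmetic Frobenius at every prime above v), then they vanish for almost all v (equivalently, by
Chebotarev + Carayol, ρ̃ is conjugate to the constant deformation). Proof route: CFT parametrisation
of H¹ by v ∈ gl₂ with unit constraints; derivative = ℚ̄-linear form in p-adic logs of ℓ-units of the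
ad⁰ρ-field H (DLR 2017 Thm 1.9 generalised); the ℚ̄-span Z ⊂ 𝓛̃⁵ of ≥ 21 prime columns (Λ(ℓ), q_ℓ),
ℓ spread over every regular Frobenius class, lies in U = K·Z ⊂ ker(v, −c₀) ≠ K⁵; Roy 1992 Thm 4 (K =
ℂ_p)/Thm 5 (dim_ℚ̄(U ∩ 𝓛̃⁵) ≤ φ(n,5) ≤ 20 when U ∩ ℚ̄⁵ = 0 and U is in no proper rational subspace)
plus a census of rational subspaces T ⊂ K⁵ (prime columns carry private logarithms by Baker–Brumer;
the X-coefficient vectors of prime ℓ lie in the centralizer plane span(1, ρ(Frob_𝔩)); for each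
nonzero w ∈ gl₂( -/
@[route_item "route-Langlands-AlgebraicTraceRigidity"]
def TangentRigidity : Prop :=
  ∀ (p : ℕ) [Fact p.Prime] (ρ : Literature.NumberTheory.GaloisRepresentations.FramedGaloisRep ℚ (PadicAlgCl p) 2) (ρε : Literature.NumberTheory.GaloisRepresentations.FramedGaloisRep ℚ (DualNumber (PadicAlgCl p)) 2), Finite ρ.toMonoidHom.range → ρ.toGaloisRep.IsIrreducible → ρ.IsOdd → (∀ g : Field.absoluteGaloisGroup ℚ, ((ρε g).val).map TrivSqZeroExt.fst = (ρ g).val) → (∀ᶠ v : IsDedekindDomain.HeightOneSpectrum (NumberField.RingOfIntegers ℚ) in Filter.cofinite, ρε.IsUnramifiedAt v) → ∀ c₀ : PadicAlgCl p, (∀ᶠ v : IsDedekindDomain.HeightOneSpectrum (NumberField.RingOfIntegers ℚ) in Filter.cofinite, ∀ Pv ∈ v.primesAbove, ∀ σ : Field.absoluteGaloisGroup ℚ, IsArithFrobAt (NumberField.RingOfIntegers ℚ) σ Pv → ∃ a : PadicAlgCl p, IsAlgebraic ℚ a ∧ ((ρε σ).val.trace).snd = c₀ * a) → ∀ᶠ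 v : IsDedekindDomain.HeightOneSpectrum (NumberField.RingOfIntegers ℚ) in Filter.cofinite, ∀ Pv ∈ v.primesAbove, ∀ σ : Field.absoluteGaloisGroup ℚ, IsArithFrobAt (NumberField.RingOfIntegers ℚ) σ Pv → ((ρε σ).val.trace).snd = 0

/-- item stmt-Langlands-8555 · crux · rank 3 · closed · moot by None · by planner
why it might fail: Values of a non-CM Hida family's Iwasawa functions at zeta-1, finitely far from the classical point, have no closed form in logs; joint irrationality is of p-adic-Schanuel strength, beyond Baker-Roy methods; one ordinary non-classical weight-one eigenform with number-field eigenvalues kills it.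
sources: Hida2010, doi:10.1007/978-3-319-41424-9_4, Kisin2003, Khare2002, arXiv:math/0309283, BockleHui2024
[crux] ATR on the ordinary Artin-weight locus of GL₂/ℚ (the card's Rung 2 = weight-one fibre of Hida
families, stated for all such ρ): p prime, ρ : Γ_ℚ → GL₂(ℚ̄_p) continuous, irreducible, unramified
at almost all v, E-rational (a number field E ⊂ ℚ̄_p contains the Frobenius characteristic
polynomials at almost all v), and at v = p ordinary of Artin weight (in some frame ρ|_{Γ_{ℚ_p}} is
upper triangular with both diagonal characters of finite order m on the inertia group absInertia
ℚ_p); then ρ(I_p) is finite (equivalently ρ|_{Γ_{ℚ_p}} is potentially unramified = de Rham of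
Hodge–Tate weights (0,0); with oddness this is a classical weight-one point). Contrapositive: a
non-classical ordinary p-adic eigenform of weight one has a Hecke field of infinite degree. No
parity hypothesis (ATR has none). [difficulty: open-problem] -/
@[route_item "route-Langlands-AlgebraicTraceRigidity"]
def OrdinaryArtinWeightRigidity : Prop :=
  ∀ (p : ℕ) [Fact p.Prime] (ρ : Literature.NumberTheory.GaloisRepresentations.FramedGaloisRep ℚ (PadicAlgCl p) 2), ρ.toGaloisRep.IsIrreducible → (∀ᶠ v : IsDedekindDomain.HeightOneSpectrum (NumberField.RingOfIntegers ℚ) in Filter.cofinite, ρ.IsUnramifiedAt v) → (∃ E : IntermediateField ℚ (PadicAlgCl p), FiniteDimensional ℚ E ∧ ∀ᶠ v : IsDedekindDomain.HeightOneSpectrum (NumberField.RingOfIntegers ℚ) in Filter.cofinite, ∃ P : Polynomial (PadicAlgCl p), (∀ i, P.coeff i ∈ E) ∧ ρ.HasFrobCharpolyAt v P) → ∀ v : IsDedekindDomain.HeightOneSpectrum (NumberField.RingOfIntegers ℚ), ((p : ℕ) : NumberField.RingOfIntegers ℚ) ∈ v.asIdeal → (∃ m : ℕ, 0 < m ∧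 ∃ Q : Matrix.GeneralLinearGroup (Fin 2) (PadicAlgCl p), ∀ σ : Field.absoluteGaloisGroup (v.adicCompletion ℚ), (Q⁻¹ * ρ.toLocal v σ * Q).val 1 0 = 0 ∧ (σ ∈ Literature.NumberTheory.GaloisRepresentations.absInertia (v.adicCompletion ℚ) → (Q⁻¹ * ρ.toLocal v σ * Q).val 1 1 ^ m = 1 ∧ (Q⁻¹ * ρ.toLocal v σ * Q).val 0 0 ^ m = 1)) → Set.Finite ((fun σ => ρ.toLocal v σ) '' (Literature.NumberTheory.GaloisRepresentations.absInertia (v.adicCompletion ℚ) : Set (Field.absoluteGaloisGroup (v.adicCompletion ℚ))))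

-- item stmt-Langlands-8571 · support · rank 4 · closed · moot by None · by planner — informal only, no Lean statement yet:
--   [crux] FiniteSlopeArtinWeightRigidity — the finite-slope (trianguline) sector of ATR over ℚ, n = 2 =
--   the card's automorphic avatar UDC_p pulled back to the Galois side through Kisin2003 + Emerton's
--   local–global compatibility + Coleman classicality (rank 4; informal until the requested notion
--   TriangulineAt lands, then typed by tenure exactly like OrdinaryArtinWeightRigidity with "ordinary"
--   replaced by "trianguline at p with parameters (δ₁, δ₂) that are locally algebraic of weights (0,0)
--   up to finite order"). CLAIM: p prime, ρ : Γ_ℚ → GL₂(ℚ̄_p) continuous, irreducible, unramified at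
--   almost all v

/-- item stmt-Langlands-8556 · support · rank 9 · closed · moot by None · by planner
sources: Brumer1967, DarmonLauderRotger2017, DarmonLauderRotger2015, BellaicheDimitrov2013
[support] The CM case of T1 with fixed determinant — the rank-one shadow provable from Baker–Brumer
alone: ρ as in TangentRigidity and moreover reducible on Γ_K for an imaginary quadratic K (ρ ≅
Ind_K^ℚ χ), ρ̃ with det ρ̃ constant to first order; then H¹(ad⁰ρ) = (anticyclotomic line) ⊕ (line
from Ind(χ/χ^c)), the two lines have derivatives supported on split, resp. inert, primes, each a
single log-form up to the unknown scalar, and ratios of two of them are ℚ̄-irrational by Brumer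
(private ℓ-unit logarithms) unless the forms vanish (χ(λ) = χ(λ̄), resp. tr(v_ψ ρ(Frob_ℓ)) = 0),
which Chebotarev defeats. Calibration item (DLR 2017 Thms 2.1 and CM-p-inert give the explicit
coefficients in this case); a corollary of TangentRigidity (Sketch.lean:
tangentRigidityCM_of_tangentRigidity). [difficulty: M] -/
@[route_item "route-Langlands-AlgebraicTraceRigidity"]
def TangentRigidityCM : Prop :=
  ∀ (p : ℕ) [Fact p.Prime] (ρ : Literature.NumberTheory.GaloisRepresentations.FramedGaloisRep ℚ (PadicAlgCl p) 2) (ρε : Literature.NumberTheory.GaloisRepresentations.FramedGaloisRep ℚ (DualNumber (PadicAlgCl p)) 2) (K : Type) [Field K] [NumberField K], NumberField.IsTotallyComplex K → Module.finrank ℚ K = 2 → ¬ (ρ.restrictField K).toGaloisRep.IsIrreducible → Finite ρ.toMonoidHom.range → ρ.toGaloisRep.IsIrreducible → ρ.IsOdd → (∀ g : Field.absoluteGaloisGroup ℚ, ((ρε g).val).map TrivSqZeroExt.fst = (ρ g).val) → (∀ g : Field.absoluteGaloisGroup ℚ, ((ρε g).val.det).snd = 0) → (∀ᶠ v : IsDedekindDomain.HeightOneSpectrum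 (NumberField.RingOfIntegers ℚ) in Filter.cofinite, ρε.IsUnramifiedAt v) → ∀ c₀ : PadicAlgCl p, (∀ᶠ v : IsDedekindDomain.HeightOneSpectrum (NumberField.RingOfIntegers ℚ) in Filter.cofinite, ∀ Pv ∈ v.primesAbove, ∀ σ : Field.absoluteGaloisGroup ℚ, IsArithFrobAt (NumberField.RingOfIntegers ℚ) σ Pv → ∃ a : PadicAlgCl p, IsAlgebraic ℚ a ∧ ((ρε σ).val.trace).snd = c₀ * a) → ∀ᶠ v : IsDedekindDomain.HeightOneSpectrum (NumberField.RingOfIntegers ℚ) in Filter.cofinite, ∀ Pv ∈ v.primesAbove, ∀ σ : Field.absoluteGaloisGroup ℚ, IsArithFrobAt (NumberField.RingOfIntegers ℚ) σ Pv → ((ρε σ).val.trace).snd = 0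

/-- item stmt-Langlands-8557 · support · rank 9 · closed · moot by None · by planner
sources: BuzzardGeeLMS2014, FontaineMazurGeometric1995, planner Sketch.lean (rc 0)
[support] The summit wiring of ATR (card N4), for every number field F, reciprocity data 𝓡, n and
level hypothesis hcpt: if every irreducible E-rational (a.e. unramified, Frobenius polynomials in
E[X] for one number field E ⊂ ℚ̄_ℓ) ρ : Γ_F → GL_n(ℚ̄_ℓ) is IsGeometricFramed 𝓡 ρ (ATR(𝓡)), and
every L-algebraic cuspidal π has for all ℓ, ι an irreducible E-rational ρ with Corresponds 𝓡 ι π ρ,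
unique up to conjugacy ((A)_rat), then AutomorphicToGalois n 𝓡 hcpt. Two-line term proof
(Sketch.lean: rationalToGeometricWiring_holds, rc 0). It records formally where ATR plugs into the
summit: (A)_rat keeps Satake matching and local–global compatibility and drops only the explicit de
Rham clause. [difficulty: provable-now] -/
@[route_item "route-Langlands-AlgebraicTraceRigidity"]
def RationalToGeometricWiring : Prop :=
  ∀ (F : Type) [Field F] [NumberField F] (RD : Summit.Langlands.ReciprocityData F) (n : ℕ) (hcpt : Literature.NumberTheory.Automorphic.isCompact_glFiniteIntegralLevel n F), (∀ (ℓ : ℕ) [Fact ℓ.Prime] (ρ : Literature.NumberTheory.GaloisRepresentations.FramedGaloisRep F (PadicAlgCl ℓ) n), ρ.toGaloisRep.IsIrreducible → (∃ E : IntermediateField ℚ (PadicAlgCl ℓ), FiniteDimensional ℚ E ∧ ∀ᶠ v : IsDedekindDomain.HeightOneSpectrum (NumberField.RingOfIntegers F) in Filter.cofinite, ρ.IsUnramifiedAt v ∧ ∃ P : Polynomial (PadicAlgCl ℓ), (∀ i, P.coeff i ∈ E) ∧ ρ.HasFrobCharpolyAt v P) → Summit.Langlands.IsGeometricFramed RD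 ρ) → (∀ π : Literature.NumberTheory.Automorphic.CuspidalAutomorphicRepData n F hcpt, π.1.IsLAlgebraic → ∀ (ℓ : ℕ) [Fact ℓ.Prime] (ι : PadicAlgCl ℓ ≃+* ℂ), ∃ ρ : Literature.NumberTheory.GaloisRepresentations.FramedGaloisRep F (PadicAlgCl ℓ) n, ρ.toGaloisRep.IsIrreducible ∧ (∃ E : IntermediateField ℚ (PadicAlgCl ℓ), FiniteDimensional ℚ E ∧ ∀ᶠ v : IsDedekindDomain.HeightOneSpectrum (NumberField.RingOfIntegers F) in Filter.cofinite, ρ.IsUnramifiedAt v ∧ ∃ P : Polynomial (PadicAlgCl ℓ), (∀ i, P.coeff i ∈ E) ∧ ρ.HasFrobCharpolyAt v P) ∧ Summit.Langlands.Corresponds RD ι π.1 ρ ∧ ∀ ρ' : Literature.NumberTheory.GaloisRepresentations.FramedGaloisRep F (PadicAlgCl ℓ) n, Summit.Langlands.Corresponds RD ι π.1 ρ' → Summit.Langlands.IsConjugate ρ ρ') → Summit.Langlands.AutomorphicToGalois n RD hcpt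

-- earlier Assembly (stmt-Langlands-8558, replaced 2026-08-15T13:13:57Z -> stmt-Langlands-8568): retired by None — TangentRigidity → OrdinaryArtinWeightRigidity → Target
/-- item stmt-Langlands-8568 · assembly · rank 1 · closed · moot by None · by planner
sources: planner Sketch.lean (rc 0, assembly_holds)
[assembly] TangentRigidity → OrdinaryArtinWeightRigidity → Target. -/
@[route_item "route-Langlands-AlgebraicTraceRigidity"]
def Assembly : Prop :=
  OrdinaryArtinWeightRigidity → TangentRigidity → Target

end Summit.Langlands.Langlands.Theses.AlgebraicTraceRigidity
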